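import Summits.NavierStokesRegularity.FluidComputer.LeraySupClock
import Literature.Analysis.FluidPDE.KNSSNoAxisymmetricTypeIHolds
import Literature.Analysis.FluidPDE.ClassicalSolutionGlue
import HarnessLib

/-!
# Fluid computer — the level dictionary, SYMMETRY FACE (L40): an axisymmetric blow-up is Type II and breaks the
# `C/r` bound (Koch–Nadirashvili–Seregin–Šverák)

HONEST FRAMING (cell `pub-fluidc`, verbatim): *low prior, high value-of-information experiment on Tao's
machine paradigm; NOT a claim that NS blows up.* Theorem side of the cell; nothing here is evidence of blow-up.
L21/L30 say that every blow-up is AT LEAST Type I: `‖u(t)‖_∞ ≥ c√ν/√(T − t)`. For AXISYMMETRIC solutions (swirl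
allowed) the Liouville theorems of Koch–Nadirashvili–Seregin–Šverák (Acta Math. 203 (2009), Thms. 6.1–6.2) and
Seregin–Šverák (Comm. PDE 34 (2009), Thms. 1.1–1.2) exclude the Type I regime altogether — PROVED in the tree as
`knss_no_axisymmetric_typeI_holds` (for classical Leray–Hopf solutions bounded on closed sub-slabs). Read on the
class of the dictionary (restart at an a.e.-good time, where the translate is bounded on closed sub-slabs by
interior boundedness `LeraySupClock.exists_bound_window`; glue back with `HasSmoothExtensionPast.of_translate`):
for every maximal smooth solution `(u, p)` of the unforced Navier–Stokes system on `ℝ³ × [0, T)` (`ν > 0`) which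
is Leray–Hopf from `u 0` and whose slices are axisymmetric (`IsAxisymmetric (u t)`, rotations about the
`x₂`-axis),

* `not_isTypeIBlowup` (**L40 — AN AXISYMMETRIC BLOW-UP IS TYPE II**): `¬ IsTypeIBlowup u T`, i.e.
  (`frequently_exceeds_selfSimilar_rate`) for every `C`, frequently as `t ↑ T`, some `x` has
  `‖u(t, x)‖ > C/√(T − t)` — `limsup_{t↑T} √(T − t)‖u(t)‖_∞ = ∞`: together with L21 the amplitude of an axisymmetric
  machine leaves the self-similar corridor `[c√ν, C]/√(T − t)` upward along a sequence of times;
* `cylRadius_mul_norm_unbounded_window` (**L40′ — THE `C/r` BOUND BREAKS**): for every `C` and every `t₀ < T` some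
  `t ∈ [t₀, T)` and `x` have `r(x)·‖u(t, x)‖ > C` (`r` the distance to the axis): the scale-invariant swirl-type
  bound `|u| ≤ C/r` fails in every terminal window;
* `symmetry_face`: both assembled.

Reading for the machine paradigm (words): a design with continuous rotational symmetry (colliding / leapfrogging
vortex rings, swirling or not) cannot blow up at the minimal (self-similar, Type I) rate and cannot keep
`|u| ≲ 1/r`; by CKN its singular points lie on the axis, where L37″ allows only a null set of them. (The swirl-free
case is excluded outright: `NoAxisymNoSwirlWitness`, p2 gen 2.) Class `ℝ³`, axis fixed; qualitative. Necessity
only. 0 sorry; no new definitions, no named facts.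

## References

* G. Koch, N. Nadirashvili, G. Seregin, V. Šverák, Acta Math. 203 (2009) 83–105, Thms. 6.1–6.2.
  [KochNadirashviliSereginSverak2009]
* G. Seregin, V. Šverák, Comm. PDE 34 (2009) 171–201, Thms. 1.1–1.2. [SereginSverak2009]
* C.-C. Chen, R. M. Strain, T.-P. Tsai, H.-T. Yau, Comm. PDE 34 (2009) 203–232. [ChenStrainTsaiYau2009]
-/

noncomputable section

open MeasureTheory Set Function Filter Topology Metric
open scoped ENNReal NNReal
open Literature.Analysis.FluidPDE Literature.Analysis.FunctionSpaces
open Summit.NavierStokesRegularity.FluidComputer.LeraySupClock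

namespace Summit.NavierStokesRegularity.FluidComputer.SymmetryFace

/-- **KNSS on the class, after a restart.** Let `(u, p)` be a maximal smooth solution of the unforced
Navier–Stokes system on `ℝ³ × [0, T)` (`ν > 0`, `T > 0`), Leray–Hopf from `u 0`, with axisymmetric slices. Then
for every `t₀ ∈ [0, T)` NEITHER the Type I bound at `T` NOR a bound `r(x)‖u(t, x)‖ ≤ C` on `[t₀, T) × ℝ³` holds:
restart at an a.e.-good time `s ∈ (t₀, T)` (`IsLerayHopfOn.exists_isLerayHopfOn_restart_Ioo`); the translate
`u(· + s)` is classical on `[0, T − s)`, Leray–Hopf from `u s`, bounded on every `[0, T'] × ℝ³`, `T' < T − s`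
(`exists_bound_window`), axisymmetric, and inherits either bound; `knss_no_axisymmetric_typeI_holds` continues it
past `T − s`, and `HasSmoothExtensionPast.of_translate` continues `u` past `T` — contradicting maximality.
[cite: KochNadirashviliSereginSverak2009, Thms 6.1–6.2] [cite: SereginSverak2009, Thms 1.1–1.2] -/
theorem not_typeI_or_axisBound_window {ν T : ℝ} (hν : 0 < ν) (hT : 0 < T)
    {u : ℝ → EuclideanSpace ℝ (Fin 3) → EuclideanSpace ℝ (Fin 3)} {p : ℝ → EuclideanSpace ℝ (Fin 3) → ℝ}
    (hmax : IsMaximalSmoothSolution ν 0 u p T) (hLH : IsLerayHopfOn T ν 0 (u 0) u)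
    (haxi : ∀ t ∈ Ico 0 T, IsAxisymmetric (u t)) {t₀ : ℝ} (ht₀ : t₀ ∈ Ico 0 T) :
    ¬ (IsTypeIBlowup u T ∨ ∃ C : ℝ, ∀ t ∈ Ico t₀ T, ∀ x, cylRadius x * ‖u t x‖ ≤ C) := by
  intro hor
  -- an a.e.-good restart time `s ∈ (t₀, T)`
  obtain ⟨s, hs, hLHs⟩ := hLH.exists_isLerayHopfOn_restart_Ioo hν.le ht₀.1 ht₀.2 le_rfl
  have hs0 : 0 < s := ht₀.1.trans_lt hs.1
  have hTs : 0 < T - s := sub_pos.2 hs.2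
  -- the translate: classical, Leray–Hopf, bounded on closed sub-slabs, axisymmetric
  have hcl' : IsClassicalNSSolutionOn (Ico 0 (T - s)) ν 0 (fun t => u (t + s)) (fun t => p (t + s)) :=
    hmax.1.translate_Ico_zero hs0.le
  have hLH' : IsLerayHopfOn (T - s) ν 0 ((fun t => u (t + s)) 0) (fun t => u (t + s)) := by
    show IsLerayHopfOn (T - s) ν 0 (u (0 + s)) (fun t => u (t + s))
    rw [zero_add]
    exact hLHs
  have hbdd' : ∀ T' < T - s, ∃ M : ℝ, ∀ t ∈ Icc 0 T', ∀ x, ‖(fun t => u (t + s)) t x‖ ≤ M := by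
    intro T' hT'
    obtain ⟨M, hM⟩ := exists_bound_window hν hT hmax.1 hLH hs0 (T' := T' + s) (by linarith)
    exact ⟨M, fun t ht x => hM (t + s) ⟨by linarith [ht.1], by linarith [ht.2]⟩ x⟩
  have haxi' : ∀ t ∈ Ico 0 (T - s), IsAxisymmetric ((fun t => u (t + s)) t) :=
    fun t ht => haxi (t + s) ⟨by linarith [ht.1, hs0], by linarith [ht.2]⟩
  -- either bound is inherited
  have hor' : IsTypeIBlowup (fun t => u (t + s)) (T - s) ∨
      ∃ C : ℝ, ∀ t ∈ Ico 0 (T - s), ∀ x, cylRadius x * ‖(fun t => u (t + s)) t x‖ ≤ C := by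
    rcases hor with ⟨C, hC⟩ | ⟨C, hC⟩
    · left
      refine ⟨C, ?_⟩
      obtain ⟨a, haT, ha⟩ := (nhdsLT_basis T).eventually_iff.1 hC
      have hmem : Ioo (a - s) (T - s) ∈ 𝓝[<] (T - s) := Ioo_mem_nhdsLT (by linarith)
      filter_upwards [hmem] with τ hτ
      intro x
      have hτs : τ + s ∈ Ioo a T := ⟨by linarith [hτ.1], by linarith [hτ.2]⟩
      have h := ha hτs x
      have e : T - s - τ = T - (τ + s) := by ring
      rw [e]
      exact h
    · right
      exact ⟨C, fun t ht x => hC (t + s) ⟨by linarith [ht.1, hs.1], by linarith [ht.2]⟩ x⟩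
  -- KNSS continues the translate, hence `u`
  have hext : HasSmoothExtensionPast ν 0 (fun t => u (t + s)) (T - s) :=
    knss_no_axisymmetric_typeI_holds hν hTs hcl' hLH' hbdd' haxi' hor'
  exact hmax.2 (HasSmoothExtensionPast.of_translate hmax.1 hs0 hs.2 hext)

/-! ## L40: Type II -/

/-- **L40 — AN AXISYMMETRIC BLOW-UP IS TYPE II.** For `ν > 0`, `T > 0` and every maximal smooth solution `(u, p)`
of the unforced Navier–Stokes system on `ℝ³ × [0, T)` which is Leray–Hopf from `u 0` and has axisymmetric slices:
`¬ IsTypeIBlowup u T` — no bound `‖u(t, x)‖ ≤ C/√(T − t)` holds for all `x` and all `t < T` near `T`.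
[cite: KochNadirashviliSereginSverak2009, Thm 6.2] [cite: SereginSverak2009, Thm 1.1] -/
theorem not_isTypeIBlowup {ν T : ℝ} (hν : 0 < ν) (hT : 0 < T)
    {u : ℝ → EuclideanSpace ℝ (Fin 3) → EuclideanSpace ℝ (Fin 3)} {p : ℝ → EuclideanSpace ℝ (Fin 3) → ℝ}
    (hmax : IsMaximalSmoothSolution ν 0 u p T) (hLH : IsLerayHopfOn T ν 0 (u 0) u)
    (haxi : ∀ t ∈ Ico 0 T, IsAxisymmetric (u t)) : ¬ IsTypeIBlowup u T :=
  fun h => not_typeI_or_axisBound_window hν hT hmax hLH haxi (t₀ := 0) ⟨le_rfl, hT⟩ (Or.inl h)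

/-- **L40, unfolded — the amplitude leaves the self-similar corridor upward**: for every `C`, frequently as
`t ↑ T`, some `x` has `C/√(T − t) < ‖u(t, x)‖`, i.e. `limsup_{t↑T} √(T − t)·‖u(t)‖_∞ = ∞`.
[cite: KochNadirashviliSereginSverak2009, Thm 6.2] [cite: SereginSverak2009, Thm 1.1] -/
theorem frequently_exceeds_selfSimilar_rate {ν T : ℝ} (hν : 0 < ν) (hT : 0 < T)
    {u : ℝ → EuclideanSpace ℝ (Fin 3) → EuclideanSpace ℝ (Fin 3)} {p : ℝ → EuclideanSpace ℝ (Fin 3) → ℝ}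
    (hmax : IsMaximalSmoothSolution ν 0 u p T) (hLH : IsLerayHopfOn T ν 0 (u 0) u)
    (haxi : ∀ t ∈ Ico 0 T, IsAxisymmetric (u t)) (C : ℝ) :
    ∃ᶠ t in 𝓝[<] T, ∃ x : EuclideanSpace ℝ (Fin 3), C / Real.sqrt (T - t) < ‖u t x‖ := by
  have h := not_isTypeIBlowup hν hT hmax hLH haxi
  rw [IsTypeIBlowup] at h
  push Not at h
  exact h C

/-! ## L40′: the `C/r` bound breaks -/

/-- **L40′ — THE SCALE-INVARIANT BOUND `|u| ≤ C/r` FAILS IN EVERY TERMINAL WINDOW.** With the same data: for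
every `C` and every `t₀ ∈ [0, T)` some `t ∈ [t₀, T)` and `x` have `C < r(x)·‖u(t, x)‖`, `r(x)` the distance to
the symmetry axis (`cylRadius`). [cite: KochNadirashviliSereginSverak2009, Thm 6.1] [cite: SereginSverak2009, Thm 1.2] -/
theorem cylRadius_mul_norm_unbounded_window {ν T : ℝ} (hν : 0 < ν) (hT : 0 < T)
    {u : ℝ → EuclideanSpace ℝ (Fin 3) → EuclideanSpace ℝ (Fin 3)} {p : ℝ → EuclideanSpace ℝ (Fin 3) → ℝ}
    (hmax : IsMaximalSmoothSolution ν 0 u p T) (hLH : IsLerayHopfOn T ν 0 (u 0) u)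
    (haxi : ∀ t ∈ Ico 0 T, IsAxisymmetric (u t)) (C : ℝ) {t₀ : ℝ} (ht₀ : t₀ ∈ Ico 0 T) :
    ∃ t ∈ Ico t₀ T, ∃ x : EuclideanSpace ℝ (Fin 3), C < cylRadius x * ‖u t x‖ := by
  by_contra hno
  push Not at hno
  exact not_typeI_or_axisBound_window hν hT hmax hLH haxi ht₀ (Or.inr ⟨C, hno⟩)

/-- **THE SYMMETRY FACE, ASSEMBLED**: an axisymmetric maximal smooth Leray–Hopf solution is not Type I at its
lifespan, and `r|u|` is unbounded on every terminal window.
[cite: KochNadirashviliSereginSverak2009, Thms 6.1–6.2] [cite: SereginSverak2009, Thms 1.1–1.2] -/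
theorem symmetry_face {ν T : ℝ} (hν : 0 < ν) (hT : 0 < T)
    {u : ℝ → EuclideanSpace ℝ (Fin 3) → EuclideanSpace ℝ (Fin 3)} {p : ℝ → EuclideanSpace ℝ (Fin 3) → ℝ}
    (hmax : IsMaximalSmoothSolution ν 0 u p T) (hLH : IsLerayHopfOn T ν 0 (u 0) u)
    (haxi : ∀ t ∈ Ico 0 T, IsAxisymmetric (u t)) :
    ¬ IsTypeIBlowup u T ∧
      ∀ C : ℝ, ∀ t₀ ∈ Ico 0 T, ∃ t ∈ Ico t₀ T, ∃ x : EuclideanSpace ℝ (Fin 3), C < cylRadius x * ‖u t x‖ :=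
  ⟨not_isTypeIBlowup hν hT hmax hLH haxi,
    fun C _ ht₀ => cylRadius_mul_norm_unbounded_window hν hT hmax hLH haxi C ht₀⟩

end Summit.NavierStokesRegularity.FluidComputer.SymmetryFace

end
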